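import Summits.BirchSwinnertonDyer.Rank1Residual.X11b.Three.ZhangAtThreeNonsplit
import Summits.BirchSwinnertonDyer.Rank1Residual.X11b.Three.HeegnerIndexCertificate
import Summits.BirchSwinnertonDyer.BirchSwinnertonDyer.Theorems.RungK2Hub
import Literature.NumberTheory.EllipticCurves.Rank1Residual.X9NoEntry
import Literature.NumberTheory.EllipticCurves.BSDSelmerSkinnerProofs

/-!
# Route `ClassRecordThree` (rung K2@3, D-0059) — the Kolyvagin road CLOSES `BSD(E,3)` on atom A1 at ONE odd
# Heegner datum: a non-zero mod-3 Kolyvagin class + McCallum + the published inputs ⟹ `BSDp W 3`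
# (cell `bsd-stepL`, seat `bsd-stepL-koly` g6; `--supports stmt-BirchSwinnertonDyer-19106`)

The END-TO-END form of the Kolyvagin road at `3 ∥ N` in the class record's vocabulary, composing two tree
kernels: `Koly.indexLowerBoundAt_of_kolyvaginClass_one_ne_zero_of_mccallum`
(`X11b/Three/KolyvaginNonvanishing.lean`: a non-zero class `c₁(n)`, `n ∈ Λ`, is a level-1 certificate, so
McCallum's `ord₃ #Ш(E/K) = 2(M₀ − M_∞)` gives STEP L `X11b.IndexLowerBoundAt W 3 K P`) and
`X11b.bsdp_of_indexLowerBoundAt_of_heegnerData_of_odd` (`X11b/BDPRouteRigidity.lean`: STEP L at ONE odd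
Heegner datum on A1 ∧ (ram) gives `BSD(E,3)` — Gross–Zagier, Kolyvagin's bound, Skinner 2016 Thm C for the
rank-0 twist, GZK, modularity). The binder list is that of the tree's certificate endpoint
`ClassX11b.bsdp_three_of_heegnerIndexCertificate` (`X11b/Three/HeegnerIndexCertificate.lean`) with the index
certificate `3 ∤ [E(K):ℤP]` REPLACED by the Kolyvagin road's inputs: a conductor-1 Kolyvagin–Heegner datum `d₁`
for `(Dt, β, ι)` whose derived point descends to `P`, the arithmetic of `E(K)` (rank 1, no 3-torsion, `Ш`
finite, `3^{M₀} ∥ P`), ONE non-zero class `c₁(n) ≠ 0` at a square-free product `n` of Kolyvagin primes for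
the same `(Dt, β, ι)` — the conclusion of the typed conjectures `Koly.ZhangAtThree…` for the datum they
name — and the McCallum structure fact. Tower surjectivity at the multiplicative 3 is the tree theorem
`surjective_pow_three_of_mult_of_tateLine`; `Surj` from `Irr ∧ Ram` (`surj_of_irr_of_ram`); non-CM from the
multiplicative prime; `d_K ≠ −3` from the Heegner hypothesis at `3 ∣ N` and `3 ∤ #𝓞_K^×`
(`not_dvd_discr_and_not_dvd_torsionOrder_of_heegner`); `d_K ≠ −4` from `d_K` odd. THEOREMS ONLY; nothing is
asserted about Kolyvagin's conjecture: the non-zero class is a HYPOTHESIS (`hne`). This is the form in which an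
ALTERNATIVE decomposition of the rung K2@3 on A1 (`3 ∤ ∏c`) can consume `Koly.ZhangAtThreeSharp`
(p408750; memo MEMO-v4, referee g17 PASS) in place of `SchneiderAtThree`'s non-split clause and of
`HalvesAtThree`'s (ram ∧ split) clause.
-/

noncomputable section

open scoped Classical

namespace Summit.BirchSwinnertonDyer.Rank1Residual.X11b.Three.Koly

open WeierstrassCurve Literature.NumberTheory.EllipticCurves
  Literature.NumberTheory.EllipticCurves.ModularForms
  Literature.NumberTheory.EllipticCurves.Rank1Residual
  Summit.BirchSwinnertonDyer.Rank1Residual Summit.BirchSwinnertonDyer.Rank1Residual.X11b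

/-- **KOLYVAGIN ROAD, END TO END, at `p = 3` on A1 ∧ (ram): one non-zero mod-3 Kolyvagin class at one odd
Heegner datum ⟹ `BSD(E,3)`.** For `(E,3)` in class X11b (`ClassX11b W 3`: `r_an = 1`, `3 ∥ N` multiplicative —
split or non-split —, `E[3]` irreducible) with a (ram) witness and `3 ∤ ∏_ℓ c_ℓ(E)`; an imaginary quadratic `K`
with ODD `d_K`, Heegner for `N_E`, `L(E^{d_K}, 1) ≠ 0` (with a minimal model `Wd` of the twist); a modular
parametrisation datum `Dt` of level `N_E` with `3 ∤ c(Dt)`, an oriented Heegner datum `H` and `ι : K → ℂ` with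
the Heegner point `P ∈ E(K)`, `P ↦ heegnerPointComplex Dt H`; a conductor-1 Kolyvagin–Heegner datum `d₁` for
`(Dt, β, ι)` whose derived point is `P` in `E(K̄)`; `P` of infinite order with `3^{M₀} ∥ P` in `E(K)`, `E(K)`
of rank one without 3-torsion, `Ш(E/K)` finite; the published inputs Gross–Zagier, Kolyvagin (qualitative and
Thm A/McCallum's bound), Skinner 2016 Thm C, GZK, modularity (named facts `hGZ hKo hB hSk hGZK hmod`): IF some
Kolyvagin–Heegner datum `d` at a square-free product `n` of Kolyvagin primes for `(Dt, β, ι)` has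
`c₁(n) ≠ 0` (`hne` — the content of Kolyvagin's conjecture at `3 ∥ N` for this datum; HYPOTHESIS) and the
McCallum structure fact holds (`hMc`), THEN `BSDp W 3`. Proof: `c₁(n) ≠ 0` ⟹ `X11b.IndexLowerBoundAt W 3 K P`
(`indexLowerBoundAt_of_kolyvaginClass_one_ne_zero_of_mccallum`, with `Surj` from `Irr ∧ Ram`, tower
surjectivity from the Tate line, non-CM from the multiplicative 3, `d_K ∉ {−3,−4}` from Heegner-at-3 and
oddness) ⟹ `BSDp W 3` (`bsdp_of_indexLowerBoundAt_of_heegnerData_of_odd`, with `3 ∤ #𝓞_K^×` discharged).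
CONDITIONAL on the named facts listed and on `hne`, `hMc`. [folklore]
[cite: McCallumLMS1991, §5 Cor. 5.6 (p. 310)] [cite: JetchevSkinnerWan2017, §7.4.1–7.4.2 (pp. 30–31)]
[cite: WZhang2014, Thm. 10.2 and Remark 18 (pp. 245–246)] -/
theorem ClassX11b.bsdp_three_of_kolyvaginClass_one_ne_zero_of_mccallum
    (W : WeierstrassCurve ℚ) [W.IsElliptic] [W.IsGloballyMinimal]
    [NeZero (W.conductorNorm ℤ)] (K : Type) [Field K] [NumberField K]
    (Dt : ModularParametrizationData W (W.conductorNorm ℤ))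
    (H : HeegnerDatum (W.conductorNorm ℤ) (NumberField.discr K)) (ι : K →+* ℂ)
    (P : (W.baseChange K).toAffine.Point)
    -- published inputs (named facts of the tree)
    (hGZ : gross_zagier (W.conductorNorm ℤ) W K) (hKo : kolyvagin (W.conductorNorm ℤ) W K)
    (hB : Kolyvagin1990_padicValNat_card_sha_le (W.conductorNorm ℤ) W K)
    (hSk : Skinner2016.thmC_padicValRat_bsd_rank_zero)
    (hGZK : rank_eq_analyticRank_of_analyticRank_le_one) (hmod : hasEntireLFunction_rat)
    -- the pair: A1 ∧ (ram)
    (hX : ClassX11b W 3) (hram : Ram W 3) (htam0 : ¬ 3 ∣ W.tamagawaProduct)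
    -- ONE odd Heegner datum
    (hK : IsImaginaryQuadratic K) (hodd : Odd (NumberField.discr K))
    (hHN : SatisfiesHeegnerHypothesis (W.conductorNorm ℤ) K)
    (hP : WeierstrassCurve.Affine.Point.map ι.toRatAlgHom P = heegnerPointComplex Dt H)
    (hc : ¬ (3 : ℤ) ∣ Dt.c)
    (hLt : (W.quadraticTwist (NumberField.discr K : ℚ)).entireLFunction 1 ≠ 0)
    (Wd : WeierstrassCurve ℚ) [Wd.IsElliptic] [Wd.IsGloballyMinimal] (Cd : VariableChange ℚ)
    (hWd : Cd • W.quadraticTwist (NumberField.discr K : ℚ) = Wd)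
    -- Kolyvagin–Heegner data at conductor 1 for (Dt, β, ι), descending to P; arithmetic of E(K)
    (β : ℤ) (d₁ : KolyvaginHeegnerData Dt β ι 1)
    (hPd : d₁.toGeomPoints d₁.derivedPoint = toGeomPoints (W.baseChange K) P)
    (hPinf : ¬ IsOfFinAddOrder P)
    (hrank : (W.baseChange K).mordellWeilRank = 1)
    (hiv : ∀ x : (W.baseChange K).toAffine.Point, 3 • x = 0 → x = 0)
    [Finite (W.baseChange K).sha] {M₀ : ℕ}
    (hdiv : ∃ Q : (W.baseChange K).toAffine.Point, ((3 ^ M₀ : ℕ) : ℤ) • Q = P)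
    (hndiv : ¬ ∃ Q : (W.baseChange K).toAffine.Point, ((3 ^ (M₀ + 1) : ℕ) : ℤ) • Q = P)
    -- THE KOLYVAGIN-ROAD INPUTS: a non-zero mod-3 class for this datum, and the McCallum fact
    {n : ℕ} (d : KolyvaginHeegnerData Dt β ι n)
    (hn : KolyvaginDescent.KolSupp (Zhang2014.IsKolyvaginPrime (W.conductorNorm ℤ) W K 3) n)
    (hne : d.kolyvaginClass Nat.prime_three 1 ≠ 0)
    (hMc : McCallum1991_pow_dvd_card_sha_primary_of_certificate) :
    BSDp W 3 := by
  have hmult : W.HasMultiplicativeReductionAtPrime 3 := hX.2.2.1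
  have hirr : Irr W 3 := hX.2.2.2
  have hρ : Surj W 3 := surj_of_irr_of_ram W 3 hirr hram
  -- tower surjectivity at a multiplicative 3 (Wuthrich 2014, Lemma 20; tree theorem)
  have hsurj : ∀ m : ℕ, W.HasSurjectiveModNGaloisRep (3 ^ m : ℕ) :=
    Rank1Residual.surjective_pow_three_of_mult_of_tateLine W hmult hρ
  have hCM : ¬ W.HasCM := not_hasCM_of_hasMultiplicativeReductionAtPrime' W hmult
  -- `3 ∣ N` splits in `K`: `3 ∤ d_K` and `3 ∤ #𝓞_K^×`
  obtain ⟨h3d, hμ⟩ := not_dvd_discr_and_not_dvd_torsionOrder_of_heegner hK hHN (p := 3) (by decide)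
    (dvd_conductorNorm_of_classX11b hX)
  have h3 : NumberField.discr K ≠ -3 := by
    intro h
    exact h3d (h ▸ ⟨-1, by norm_num⟩)
  have h4 : NumberField.discr K ≠ -4 := by
    intro h
    rw [h] at hodd
    exact (Int.not_odd_iff_even.mpr ⟨-2, by norm_num⟩) hodd
  -- STEP L at the datum from the non-zero class (McCallum)
  have hL : IndexLowerBoundAt W 3 K P :=
    indexLowerBoundAt_of_kolyvaginClass_one_ne_zero_of_mccallum W K hMc hCM hK h3 h4 hHN 3 (by norm_num)
      hsurj Dt β ι d₁ P hPd hPinf hrank hiv hdiv hndiv d hn hne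
  -- STEP L at ONE odd datum on A1 ∧ (ram) ⟹ BSD(E,3)
  exact bsdp_of_indexLowerBoundAt_of_heegnerData_of_odd W 3 K Dt H ι P hGZ hKo hB hSk hGZK hmod hX hram
    htam0 hK hodd hHN hP (by exact_mod_cast hc) hμ hLt Wd Cd hWd hL

end Summit.BirchSwinnertonDyer.Rank1Residual.X11b.Three.Koly

end
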